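import Literature.AnabelianGeometry.SemiGraphs.TemperedOpenMapping
import Literature.AnabelianGeometry.SemiGraphs.TemperedDecompositionCompact
import Mathlib.GroupTheory.Commutator.Basic
import HarnessLib

/-!
# Compact images through tempered groups (a corollary of the open mapping theorem for tempered groups)

Mochizuki, *Semi-graphs of anabelioids*, Publ. RIMS **42** (2006), Def. 3.1 (i) p. 33 (tempered groups)
and §6 p. 69 («the profinite completion … or, equivalently, closure in `Π_{X_K}`»)
[cite: MochizukiSemiAnbd2006, Def 3.1(i) p.33].  Refereed pre-IUT material; classical topology.
abc-iut cell, seat abc-iut-w5-d111 (gen 3); PROOF-ONLY (no definition), built on this seat's engine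
`IsTempered.isOpenMap_of_surjective` (`TemperedOpenMapping.lean`, p416385) and
`IsTempered.subgroup_of_isClosed` (`TemperedDecompositionCompact.lean`, p417615).

THE LEMMA (`IsTempered.isCompact_map_of_isCompact_map`).  Let `T` be a tempered group with
first-countable topology, `H ≤ T` a closed subgroup, `ψ : T → P` a continuous homomorphism to a
Hausdorff group such that `ψ(H)` is compact, and `θ : T → G` a continuous homomorphism to ANY
topological group with `H ∩ Ker ψ ⊆ Ker θ`.  Then `θ(H)` is compact.  (Proof: `H` is tempered and
first countable, so `ψ| : H ↠ ψ(H)` is OPEN by the open mapping theorem — `ψ(H)` is compact Hausdorff,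
hence Baire; `θ|_H` is constant on the fibres of this open surjection, so it factors through a
continuous map `ψ(H) → G`, whose range `θ(H)` is compact.)  The point: compactness is transported from
a PROFINITE SIDE (`P` = a profinite completion or a quotient of one, where closedness is checkable) to
an ABSTRACTLY TOPOLOGISED quotient `G` of which only the continuity of `θ` is known — the situation of
the [EtTh] §1 root interface `ThetaSetting.GtpTheta` (consumer file
`EtaleTheta/Discharge/Sec1ThetaCompactOfYcl.lean`).

Also recorded: the elementary inclusion `⁅cl A, cl B⁆ ≤ cl ⁅A, B⁆` for subgroups of a topological group
(`commutator_topologicalClosure_le`), used there to compare `[Δ_X, Δ_X]` with the closure of the image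
of `[Δ^tp_X, Δ^tp_X]`.  Nothing here bears on [IUTchIII] Cor. 3.12; typed ≠ discharged.
-/

namespace Literature.AnabelianGeometry.SemiGraphs

open Topology Filter Set

universe u v w

/-! ### A purely topological factorisation lemma -/

/-- If `π : X → Q` is a continuous OPEN surjection onto a compact space and `f : X → Y` is continuous and
constant on the fibres of `π`, then the range of `f` is compact (it is the range of the induced map
`Q → Y`, continuous because an open continuous surjection is a quotient map).
[cite: MochizukiSemiAnbd2006, Def 3.1(i) p.33] -/
theorem isCompact_range_of_isOpenMap_of_factors {X : Type u} {Q : Type v} {Y : Type w}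
    [TopologicalSpace X] [TopologicalSpace Q] [TopologicalSpace Y] [CompactSpace Q]
    {π : X → Q} (hπo : IsOpenMap π) (hπc : Continuous π) (hπs : Function.Surjective π)
    {f : X → Y} (hf : Continuous f) (hfac : ∀ a b, π a = π b → f a = f b) :
    IsCompact (Set.range f) := by
  classical
  -- the induced map `g : Q → Y` with `g ∘ π = f`
  let g : Q → Y := fun q => f (Function.surjInv hπs q)
  have hg : g ∘ π = f := funext fun x => hfac _ _ (Function.surjInv_eq hπs (π x))
  have hgc : Continuous g := by
    rw [(hπo.isQuotientMap hπc hπs).continuous_iff, hg]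
    exact hf
  have hrange : Set.range f = Set.range g := by
    rw [← hg, Set.range_comp, hπs.range_eq, Set.image_univ]
  rw [hrange]
  exact isCompact_range hgc

/-! ### Commutators and closures -/

section Commutator

variable {G : Type u} [Group G] [TopologicalSpace G] [IsTopologicalGroup G]

/-- In a topological group, `⁅cl A, cl B⁆ ≤ cl ⁅A, B⁆` for all subgroups `A`, `B`: a single commutator
`[x, y]` with `x ∈ cl A`, `y ∈ cl B` is a limit of commutators `[a, b]`, `a ∈ A`, `b ∈ B` (continuity of
`(x, y) ↦ x y x⁻¹ y⁻¹`), and `cl ⁅A, B⁆` is a subgroup.  (Used with `A = B =` the image of `Δ^tp_X` in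
`Π_X`, whose closure is `Δ_X`, [SemiAnbd] §6 p. 69.) [cite: MochizukiSemiAnbd2006, §6 p.69] -/
theorem commutator_topologicalClosure_le (A B : Subgroup G) :
    ⁅A.topologicalClosure, B.topologicalClosure⁆ ≤ (⁅A, B⁆).topologicalClosure := by
  rw [Subgroup.commutator_le]
  intro x hx y hy
  -- the commutator map is continuous
  let c : G × G → G := fun q => q.1 * q.2 * q.1⁻¹ * q.2⁻¹
  have hc : Continuous c := by
    show Continuous fun q : G × G => q.1 * q.2 * q.1⁻¹ * q.2⁻¹
    fun_prop
  -- `(x, y)` lies in the closure of `A × B`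
  have hxy : (x, y) ∈ closure ((A : Set G) ×ˢ (B : Set G)) := by
    rw [closure_prod_eq]
    refine ⟨?_, ?_⟩
    · show x ∈ closure (A : Set G)
      rw [← Subgroup.topologicalClosure_coe]; exact hx
    · show y ∈ closure (B : Set G)
      rw [← Subgroup.topologicalClosure_coe]; exact hy
  -- hence `[x, y]` lies in the closure of the image, which is contained in `cl ⁅A, B⁆`
  have himg : c '' ((A : Set G) ×ˢ (B : Set G)) ⊆ ((⁅A, B⁆ : Subgroup G) : Set G) := by
    rintro _ ⟨⟨a, b⟩, ⟨ha, hb⟩, rfl⟩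
    exact Subgroup.commutator_mem_commutator ha hb
  have h1 : c (x, y) ∈ closure (c '' ((A : Set G) ×ˢ (B : Set G))) :=
    image_closure_subset_closure_image hc ⟨(x, y), hxy, rfl⟩
  have h2 : c (x, y) ∈ closure (((⁅A, B⁆ : Subgroup G) : Set G)) := closure_mono himg h1
  change x * y * x⁻¹ * y⁻¹ ∈ (⁅A, B⁆).topologicalClosure
  rw [← SetLike.mem_coe, Subgroup.topologicalClosure_coe]
  simpa [commutatorElement_def] using h2

end Commutator

/-! ### Compact images through tempered groups -/

section CompactImage

variable {T : Type u} [Group T] [TopologicalSpace T] [IsTopologicalGroup T]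
variable {P : Type v} [Group P] [TopologicalSpace P] [IsTopologicalGroup P]
variable {G : Type w} [Group G] [TopologicalSpace G]

/-- **Compact images through tempered groups.**  `T` tempered ([SemiAnbd] Def. 3.1 (i)) with
first-countable topology; `H ≤ T` closed; `ψ : T → P` a continuous homomorphism into a Hausdorff group
with `ψ(H)` compact; `θ : T → G` a continuous homomorphism into any topological group with
`H ∩ Ker ψ ⊆ Ker θ`.  Then `θ(H) ⊆ G` is compact: `ψ| : H ↠ ψ(H)` is open (open mapping theorem for the
tempered, first-countable `H` onto the compact Hausdorff — hence Baire — group `ψ(H)`), and `θ|_H`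
factors continuously through it. [cite: MochizukiSemiAnbd2006, Def 3.1(i) p.33] -/
theorem IsTempered.isCompact_map_of_isCompact_map [FirstCountableTopology T] [T2Space P]
    (hT : IsTempered T) (H : Subgroup T) (hH : IsClosed (H : Set T))
    (ψ : T →* P) (hψ : Continuous ψ) (hψH : IsCompact ((H.map ψ : Subgroup P) : Set P))
    (θ : T →* G) (hθ : Continuous θ) (hker : H ⊓ ψ.ker ≤ θ.ker) :
    IsCompact ((H.map θ : Subgroup G) : Set G) := by
  classical
  have hHt : IsTempered H := hT.subgroup_of_isClosed H hH
  haveI : FirstCountableTopology H := Topology.IsInducing.subtypeVal.firstCountableTopology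
  haveI : CompactSpace (H.map ψ) := isCompact_iff_compactSpace.1 hψH
  -- `ψ| : H ↠ ψ(H)`, a continuous surjective homomorphism onto a compact Hausdorff group
  let f : H →* (H.map ψ) :=
    { toFun := fun h => ⟨ψ h, Subgroup.mem_map_of_mem ψ h.2⟩
      map_one' := Subtype.ext (by simp)
      map_mul' := fun a b => Subtype.ext (by simp) }
  have hfc : Continuous f :=
    continuous_induced_rng.2 (hψ.comp continuous_subtype_val)
  have hfs : Function.Surjective f := by
    rintro ⟨_, ⟨h, hh, rfl⟩⟩
    exact ⟨⟨h, hh⟩, rfl⟩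
  -- … is OPEN (open mapping theorem for tempered groups)
  have hfo : IsOpenMap f := hHt.isOpenMap_of_surjective f hfc hfs
  -- `θ|_H` is constant on the fibres of `f`
  have hfac : ∀ a b : H, f a = f b → θ (a : T) = θ (b : T) := by
    intro a b hab
    have h1 : ψ (a : T) = ψ (b : T) := congrArg Subtype.val hab
    have hmem : (a : T)⁻¹ * (b : T) ∈ H ⊓ ψ.ker := by
      refine Subgroup.mem_inf.2 ⟨H.mul_mem (H.inv_mem a.2) b.2, ?_⟩
      rw [MonoidHom.mem_ker, map_mul, map_inv, h1, inv_mul_cancel]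
    have h2 := hker hmem
    rw [MonoidHom.mem_ker, map_mul, map_inv, inv_mul_eq_one] at h2
    exact h2
  have hc := isCompact_range_of_isOpenMap_of_factors hfo hfc hfs
    (f := fun h : H => θ (h : T)) (hθ.comp continuous_subtype_val) hfac
  have hrange : Set.range (fun h : H => θ (h : T)) = ((H.map θ : Subgroup G) : Set G) := by
    ext x
    simp only [Set.mem_range, Subgroup.coe_map, Set.mem_image, SetLike.mem_coe, Subtype.exists,
      exists_prop]
  rw [← hrange]
  exact hc

/-- Variant with a compact Hausdorff `P` and a CLOSED image `ψ(H)` (the form used on the profinite side: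
`P` a quotient of a profinite completion by a closed normal subgroup).
[cite: MochizukiSemiAnbd2006, Def 3.1(i) p.33] -/
theorem IsTempered.isCompact_map_of_isClosed_map [FirstCountableTopology T] [T2Space P]
    [CompactSpace P] (hT : IsTempered T) (H : Subgroup T) (hH : IsClosed (H : Set T))
    (ψ : T →* P) (hψ : Continuous ψ) (hψH : IsClosed ((H.map ψ : Subgroup P) : Set P))
    (θ : T →* G) (hθ : Continuous θ) (hker : H ⊓ ψ.ker ≤ θ.ker) :
    IsCompact ((H.map θ : Subgroup G) : Set G) :=
  hT.isCompact_map_of_isCompact_map H hH ψ hψ hψH.isCompact θ hθ hker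

end CompactImage

end Literature.AnabelianGeometry.SemiGraphs
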